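import Mathlib
import HarnessLib
import Literature.Analysis.FluidPDE.AxisymmetricReflection
import Summits.NavierStokesRegularity.NavierStokesRegularity.Theorems.LocalHelicityTubeDoorFrobeniusProfileRigidityStrata
import Summits.NavierStokesRegularity.NavierStokesRegularity.Theorems.LocalVelCompTubeDoorVelCompWindowRigidity

/-!
# Door S11 `LocalTubeDoorHelicity` (nsreg-p1 ROUND-11), profile crux K2⁗ `FrobeniusProfileRigidity` — two more settled
# strata and the SHARPER residue: axisymmetric-without-swirl on ONE slice, and the strict-shadow class (S10's K2′)

Cell ns-regularity-ideate, seat p6 (route-directed support for an UNSTAGED door; anchor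
`--supports stmt-NavierStokesRegularity-20018`; edge re-pointed at birth).  Continues
`…LocalHelicityTubeDoorFrobeniusProfileRigidityStrata` (`frobeniusProfileRigidity_of_sharp`):

* `axisymmetric_noSwirl_of_slice` — for a profile of the Type-I class, «axisymmetric AND swirl-free» on ONE slice
  `s < 0` propagates to EVERY slice: axisymmetry by `…OneSlice.isAxisymmetric_of_slice`, and no-swirl because for an
  axisymmetric field it is equivariance under the meridian reflection `σ = reflY` (tree
  `IsAxisymmetric.hasNoSwirl_iff_reflY`, Majda–Bertozzi §2.3.3), a linear-isometry symmetry of one slice, which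
  propagates by `…OneSlice.conj_eq_of_slice` (bounded Oseen-mild uniqueness forward, time-analyticity backward);
* `eq_zero_of_axisymmetric_noSwirl_anyAxis_slice` — hence axisymmetric-without-swirl about ANY axis (any direction `L`,
  any centre `c`) on ONE slice ⇒ `v ≡ 0` (KNSS 2009 Thm 5.2 via `…Axisymmetric.eq_zero_of_axisymmetric_noSwirl` after
  `class_translate` + `class_conj_linearIsometryEquiv`);
* `not_backwardSingular_of_inner_eq_zero` — the STRICT-SHADOW stratum is settled: if some velocity component
  `⟪v, e⟫`, `e ≠ 0`, vanishes identically on the slab, the profile is not backward-singular — this is S10's crux K2′,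
  PROVED in the tree (`…LocalVelCompTubeDoorVelCompWindowRigidity.velCompWindowRigidity`, window `= univ`);
* `frobeniusProfileRigidity_of_sharper` — **K2⁗ (profile form) ⇐ the SHARPER residue**: the residue prover may assume,
  on EVERY slice `s < 0`: vorticity parallel to no fixed direction, no translation symmetry along any line, and
  axisymmetric-without-swirl about NO axis; and globally: scale-invariant about no centre, time-periodic with no
  period, and NO velocity component vanishing identically on the slab (`∀ e ≠ 0, ∃ s < 0, ∃ y, ⟪v s y, e⟫ ≠ 0`).
  Still NOT removed (honest): axisymmetric WITH swirl inside `𝔉`; poloidal profiles inside `𝔉` (that is K2, open).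

WHAT THIS IS NOT: not a claim about Navier–Stokes regularity and not K2⁗ — bookkeeping of settled strata for a door route
that is not yet staged (bears_on LADDER-NS N0).
-/

noncomputable section

-- the summit and its single sub-problem share the name (CONVENTIONS §1), as in every Theorems file
set_option linter.dupNamespace false

namespace Summit.NavierStokesRegularity.NavierStokesRegularity.Theorems.LocalHelicityTubeDoorFrobeniusProfileRigiditySharper

open MeasureTheory Set Function Filter Topology TopologicalSpace Metric
open scoped RealInnerProductSpace InnerProductSpace
open Literature.Analysis Literature.Analysis.FluidPDE
open Summit.NavierStokesRegularity.NavierStokesRegularity.Theorems.LocalSineTubeDoorProfileAlignedWindowRigidityAncient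
open Summit.NavierStokesRegularity.NavierStokesRegularity.Theorems.LocalSineTubeDoorProfileAlignedWindowRigidity
open Summit.NavierStokesRegularity.NavierStokesRegularity.Theorems.PoloidalWindowDoorPoloidalWindowRigidityWindow
open Summit.NavierStokesRegularity.NavierStokesRegularity.Theorems.PoloidalWindowDoorPoloidalWindowRigidityFlat
open Summit.NavierStokesRegularity.NavierStokesRegularity.Theorems.PoloidalWindowDoorPoloidalWindowRigidityRotate
open Summit.NavierStokesRegularity.NavierStokesRegularity.Theorems.PoloidalWindowDoorPoloidalWindowRigidityAxisymmetric
open Summit.NavierStokesRegularity.NavierStokesRegularity.Theorems.PoloidalWindowDoorPoloidalWindowRigidityStrata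
open Summit.NavierStokesRegularity.NavierStokesRegularity.Theorems.PoloidalWindowDoorPoloidalWindowRigidityOneSlice
open Summit.NavierStokesRegularity.NavierStokesRegularity.Theorems.LocalHelicityTubeDoorFrobeniusProfileRigidityStrata
open Summit.NavierStokesRegularity.NavierStokesRegularity.Theorems.LocalVelCompTubeDoorVelCompWindowRigidity

variable {C : ℝ} {v : ℝ → EuclideanSpace ℝ (Fin 3) → EuclideanSpace ℝ (Fin 3)}

/-! ### Axisymmetric without swirl on ONE slice -/

/-- **«Axisymmetric and swirl-free» on ONE slice propagates to every slice** of a profile of the Type-I class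
(axisymmetry: `isAxisymmetric_of_slice`; no swirl = equivariance under the meridian reflection `reflY` for axisymmetric
fields, a symmetry of one slice, hence of all by `conj_eq_of_slice`). -/
theorem axisymmetric_noSwirl_of_slice (hrate : HasTypeITimeDecay C v)
    (hcont : ContinuousOn (uncurry v) (Iio (0 : ℝ) ×ˢ univ))
    (hmild : ∀ s t : ℝ, s < t → t < 0 → ∀ x,
      v t x = UnboundedOperators.heatExtension (v s) (t - s) x - oseenDuhamel 1 s v v t x)
    (hdiv : ∀ t < 0, VectorCalculus.IsDivFree (v t)) {s : ℝ} (hs : s < 0)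
    (haxi : IsAxisymmetric (v s)) (hsw : HasNoSwirl (v s)) :
    ∀ t < 0, IsAxisymmetric (v t) ∧ HasNoSwirl (v t) := by
  have haxi0 : IsAxisymmetric (fun y => v s (y + 0)) := by
    simpa only [add_zero] using haxi
  have hall := isAxisymmetric_of_slice hrate hcont hmild hdiv 0 hs haxi0
  have hrefl : ∀ t < 0, ∀ y, reflY (v t (reflY.symm y)) = v t y :=
    conj_eq_of_slice hcont (bdd_of_hasTypeITimeDecay hrate) hmild reflY hs (fun y => haxi.conj_reflY_eq hsw y)
  intro t ht
  have haxit : IsAxisymmetric (v t) := by simpa only [add_zero] using hall t ht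
  exact ⟨haxit, haxit.hasNoSwirl_of_conj_reflY_eq (hrefl t ht)⟩

/-- **Axisymmetric without swirl about ANY axis on ONE slice ⇒ trivial**: if for some linear isometry `L`, centre `c`
and ONE `s < 0` the slice `y ↦ L⁻¹ v(s, L y + c)` is axisymmetric about the `e₃`-axis and swirl-free, then `v ≡ 0` on the
slab (propagation to all slices of the transported profile, then KNSS 2009 Thm 5.2 in the Type-I mild class). -/
theorem eq_zero_of_axisymmetric_noSwirl_anyAxis_slice (hrate : HasTypeITimeDecay C v)
    (hcont : ContinuousOn (uncurry v) (Iio (0 : ℝ) ×ˢ univ))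
    (hmild : ∀ s t : ℝ, s < t → t < 0 → ∀ x,
      v t x = UnboundedOperators.heatExtension (v s) (t - s) x - oseenDuhamel 1 s v v t x)
    (hdiv : ∀ t < 0, VectorCalculus.IsDivFree (v t))
    (L : EuclideanSpace ℝ (Fin 3) ≃ₗᵢ[ℝ] EuclideanSpace ℝ (Fin 3)) (c : EuclideanSpace ℝ (Fin 3)) {s : ℝ} (hs : s < 0)
    (haxi : IsAxisymmetric (fun y => L.symm (v s (L y + c))))
    (hsw : HasNoSwirl (fun y => L.symm (v s (L y + c)))) :
    ∀ t < 0, ∀ x, v t x = 0 := by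
  -- the translated, then conjugated profile `w t y = L⁻¹ v(t, L y + c)` is in the class
  obtain ⟨hrate₁, hcont₁, hmild₁, hdiv₁⟩ := class_translate c hrate hcont hmild hdiv
  obtain ⟨hrate₂, hcont₂, hmild₂, hdiv₂⟩ := class_conj_linearIsometryEquiv L.symm hrate₁ hcont₁ hmild₁ hdiv₁
  simp only [LinearIsometryEquiv.symm_symm] at hrate₂ hcont₂ hmild₂ hdiv₂
  have hall := axisymmetric_noSwirl_of_slice hrate₂ hcont₂ hmild₂ hdiv₂ hs haxi hsw
  exact eq_zero_of_axisymmetric_noSwirl_anyAxis hrate hcont hmild hdiv L c (fun t ht => (hall t ht).1)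
    (fun t ht => (hall t ht).2)

/-! ### The strict-shadow stratum (S10's crux K2′, proved) -/

/-- **A profile of the Type-I class with an identically vanishing velocity component is not backward-singular** — the
tree theorem `velCompWindowRigidity` (S10's crux K2′) with the window `univ`. -/
theorem not_backwardSingular_of_inner_eq_zero (hrate : HasTypeITimeDecay C v)
    (hcont : ContinuousOn (uncurry v) (Iio (0 : ℝ) ×ˢ univ))
    (hmild : ∀ s t : ℝ, s < t → t < 0 → ∀ x,
      v t x = UnboundedOperators.heatExtension (v s) (t - s) x - oseenDuhamel 1 s v v t x)
    (hdiv : ∀ t < 0, VectorCalculus.IsDivFree (v t)) {e : EuclideanSpace ℝ (Fin 3)} (he : e ≠ 0)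
    (hcomp : ∀ s < 0, ∀ y, ⟪v s y, e⟫_ℝ = 0) : ¬ IsBackwardSingularPoint v 0 :=
  velCompWindowRigidity C v hrate hcont hmild hdiv e he
    (fun s hs => ⟨univ, isOpen_univ, univ_nonempty, fun y _ => hcomp s hs y⟩)

/-! ### K2⁗ (profile form) reduced to the sharper residue -/

/-- **`FrobeniusProfileRigidity` ⇐ the SHARPER RESIDUE** (supersedes `frobeniusProfileRigidity_of_sharp` for a lead on
K2⁗): to prove that every profile of the Type-I class with identically vanishing helicity density is not backward-singular
at the apex, it suffices to treat the profiles which IN ADDITION have, on every slice `s < 0`: vorticity parallel to no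
fixed direction, no translation symmetry along any line, and NO axisymmetry-without-swirl about any axis; and which are
scale-invariant about no centre, time-periodic with no period, and have no velocity component vanishing identically on
the slab — every excluded alternative being a settled stratum (`eq_zero_of_aligned`, `eq_zero_of_translate_eq_slice`,
`eq_zero_of_axisymmetric_noSwirl_anyAxis_slice`, `eq_zero_of_scaleInvariant_centre`, `eq_zero_of_timePeriodic`,
`not_backwardSingular_of_inner_eq_zero`). -/
theorem frobeniusProfileRigidity_of_sharper
    (hsharp : ∀ (C : ℝ) (v : ℝ → EuclideanSpace ℝ (Fin 3) → EuclideanSpace ℝ (Fin 3)),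
      Literature.Analysis.FluidPDE.HasTypeITimeDecay C v →
      ContinuousOn (Function.uncurry v) (Set.Iio (0 : ℝ) ×ˢ Set.univ) →
      (∀ s t : ℝ, s < t → t < 0 → ∀ x, v t x =
        Literature.Analysis.UnboundedOperators.heatExtension (v s) (t - s) x -
          Literature.Analysis.FluidPDE.oseenDuhamel 1 s v v t x) →
      (∀ t < 0, Literature.Analysis.FluidPDE.VectorCalculus.IsDivFree (v t)) →
      (∀ s < 0, ∀ y : EuclideanSpace ℝ (Fin 3), ⟪v s y, Literature.Analysis.FluidPDE.curl (v s) y⟫_ℝ = 0) →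
      -- on every slice: vorticity parallel to no fixed direction (in particular: rotational)
      (∀ s < 0, ∀ b : EuclideanSpace ℝ (Fin 3), b ≠ 0 →
        ∃ y, Literature.Analysis.FluidPDE.cross (Literature.Analysis.FluidPDE.curl (v s) y) b ≠ 0) →
      -- on every slice: no translation symmetry along any line
      (∀ s < 0, ∀ e : EuclideanSpace ℝ (Fin 3), e ≠ 0 → ∃ (y : EuclideanSpace ℝ (Fin 3)) (l : ℝ),
        v s (y + l • e) ≠ v s y) →
      -- on every slice: axisymmetric-without-swirl about no axis (any direction, any centre)
      (∀ s < 0, ∀ (L : EuclideanSpace ℝ (Fin 3) ≃ₗᵢ[ℝ] EuclideanSpace ℝ (Fin 3)) (c : EuclideanSpace ℝ (Fin 3)),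
        ¬ (Literature.Analysis.FluidPDE.IsAxisymmetric (fun y => L.symm (v s (L y + c))) ∧
           Literature.Analysis.FluidPDE.HasNoSwirl (fun y => L.symm (v s (L y + c))))) →
      -- scale-invariant (backward self-similar) about no centre
      (∀ c : EuclideanSpace ℝ (Fin 3), ∃ lam : ℝ, 0 < lam ∧ ∃ s < 0, ∃ y,
        lam • v (lam ^ 2 * s) (lam • y + c) ≠ v s (y + c)) →
      -- time-periodic with no period (in particular: not steady)
      (∀ P : ℝ, 0 < P → ∃ s < 0, ∃ y, v (s - P) y ≠ v s y) →
      -- no velocity component vanishes identically on the slab (the strict-shadow class is S10's, settled)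
      (∀ e : EuclideanSpace ℝ (Fin 3), e ≠ 0 → ∃ s < 0, ∃ y, ⟪v s y, e⟫_ℝ ≠ 0) →
      ¬ Literature.Analysis.FluidPDE.IsBackwardSingularPoint v 0) :
    ∀ (C : ℝ) (v : ℝ → EuclideanSpace ℝ (Fin 3) → EuclideanSpace ℝ (Fin 3)),
    Literature.Analysis.FluidPDE.HasTypeITimeDecay C v →
    ContinuousOn (Function.uncurry v) (Set.Iio (0 : ℝ) ×ˢ Set.univ) →
    (∀ s t : ℝ, s < t → t < 0 → ∀ x, v t x =
      Literature.Analysis.UnboundedOperators.heatExtension (v s) (t - s) x -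
        Literature.Analysis.FluidPDE.oseenDuhamel 1 s v v t x) →
    (∀ t < 0, Literature.Analysis.FluidPDE.VectorCalculus.IsDivFree (v t)) →
    (∀ s < 0, ∀ y : EuclideanSpace ℝ (Fin 3), ⟪v s y, Literature.Analysis.FluidPDE.curl (v s) y⟫_ℝ = 0) →
    ¬ Literature.Analysis.FluidPDE.IsBackwardSingularPoint v 0 := by
  intro C v hrate hcont hmild hdiv hhel
  -- (1) a slice with unidirectional (possibly zero) vorticity
  by_cases h1 : ∃ s < 0, ∃ b : EuclideanSpace ℝ (Fin 3), b ≠ 0 ∧ ∀ y, cross (curl (v s) y) b = 0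
  · obtain ⟨s, hs, b, hb, hal⟩ := h1
    exact not_backwardSingular_of_zero (eq_zero_of_aligned hrate hcont hmild hdiv hb hs hal)
  -- (2) a slice with a translation symmetry along a line
  by_cases h2 : ∃ s < 0, ∃ e : EuclideanSpace ℝ (Fin 3), e ≠ 0 ∧ ∀ (y : EuclideanSpace ℝ (Fin 3)) (l : ℝ),
      v s (y + l • e) = v s y
  · obtain ⟨s, hs, e, he, htr⟩ := h2
    exact nonflatLiouville_of_translate_eq_slice hrate hcont hmild hdiv hs he htr
  -- (3) a slice that is axisymmetric without swirl about some axis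
  by_cases h3 : ∃ s < 0, ∃ (L : EuclideanSpace ℝ (Fin 3) ≃ₗᵢ[ℝ] EuclideanSpace ℝ (Fin 3)) (c : EuclideanSpace ℝ (Fin 3)),
      IsAxisymmetric (fun y => L.symm (v s (L y + c))) ∧ HasNoSwirl (fun y => L.symm (v s (L y + c)))
  · obtain ⟨s, hs, L, c, haxi, hsw⟩ := h3
    exact not_backwardSingular_of_zero
      (eq_zero_of_axisymmetric_noSwirl_anyAxis_slice hrate hcont hmild hdiv L c hs haxi hsw)
  -- (4) scale-invariant about some centre
  by_cases h4 : ∃ c : EuclideanSpace ℝ (Fin 3), ∀ lam : ℝ, 0 < lam → ∀ s < 0, ∀ y,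
      lam • v (lam ^ 2 * s) (lam • y + c) = v s (y + c)
  · obtain ⟨c, hsc⟩ := h4
    exact not_backwardSingular_of_zero (eq_zero_of_scaleInvariant_centre hrate hcont hmild hdiv c hsc)
  -- (5) time-periodic
  by_cases h5 : ∃ P : ℝ, 0 < P ∧ ∀ s < 0, ∀ y, v (s - P) y = v s y
  · obtain ⟨P, hP, hper⟩ := h5
    exact nonflatLiouville_of_timePeriodic hrate hP hper
  -- (6) a velocity component vanishing identically on the slab
  by_cases h6 : ∃ e : EuclideanSpace ℝ (Fin 3), e ≠ 0 ∧ ∀ s < 0, ∀ y, ⟪v s y, e⟫_ℝ = 0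
  · obtain ⟨e, he, hcomp⟩ := h6
    exact not_backwardSingular_of_inner_eq_zero hrate hcont hmild hdiv he hcomp
  -- (7) the sharper residue
  push Not at h1 h2 h4 h5 h6
  refine hsharp C v hrate hcont hmild hdiv hhel (fun s hs b hb => h1 s hs b hb) (fun s hs e he => ?_)
    (fun s hs L c hax => h3 ⟨s, hs, L, c, hax⟩) (fun c => ?_) (fun P hP => h5 P hP) (fun e he => ?_)
  · obtain ⟨y, l, h⟩ := h2 s hs e he
    exact ⟨y, l, h⟩
  · obtain ⟨lam, hlam, s, hs, y, h⟩ := h4 c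
    exact ⟨lam, hlam, s, hs, y, h⟩
  · obtain ⟨s, hs, y, h⟩ := h6 e he
    exact ⟨s, hs, y, h⟩

end Summit.NavierStokesRegularity.NavierStokesRegularity.Theorems.LocalHelicityTubeDoorFrobeniusProfileRigiditySharper

end
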